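import Mathlib
import Literature.RingTheory.CohomologyAnnihilator.AnnihilationOfCohomology
import Summits.ResolutionOfSingularities.ResolutionOfSingularities.Theses.HomologicalConductor
import Summits.ResolutionOfSingularities.ResolutionOfSingularities.Theorems.HomologicalConductorNoZenoBirthDefs
import Summits.ResolutionOfSingularities.ResolutionOfSingularities.Theorems.HomologicalConductorNoZenoTowerNoetherian
import Summits.ResolutionOfSingularities.ResolutionOfSingularities.Theorems.HomologicalConductorNoZenoDominanceInvariance
import Summits.ResolutionOfSingularities.ResolutionOfSingularities.Theorems.HomologicalConductorNoZenoPersistenceStep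
import Summits.ResolutionOfSingularities.ResolutionOfSingularities.Theorems.HomologicalConductorPersistenceLocalStep
import Summits.ResolutionOfSingularities.ResolutionOfSingularities.Theorems.HomologicalConductorPersistenceRadical
import Summits.ResolutionOfSingularities.ResolutionOfSingularities.Theorems.HomologicalConductorPersistenceRegularOffCentre
import HarnessLib

/-!
# RADICAL persistence along the canonical `ca`-tower (rung S-3 `PersistenceRadical`)

Crux `HomologicalConductor.Persistence` (stmt-ResolutionOfSingularities-16484), line `birth`, chain
W4.4b (`[OURS · L1 w44b]` — replaces the role of no printed item; NOT a statement of any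
manuscript; Iyengar–Takahashi's Theorem 5.4 enters ONLY as the named-fact hypothesis
`singEqVCa_essFiniteType`, never re-proved here).

The crux asks `ca (T_m) ⊆ ca (T_(m+1))` along the tower `T₀ = loc A`,
`T_(m+1) = loc (nrm (chart T_m))`. This file lands its **radical form** — the repaired statement
`C′` of the chain plan (rung S-3): GIVEN Theorem 5.4 (`hVCa`), every `x ∈ ca (T_m)` has a power
`x ^ N`, `N ≥ 1`, in `ca (T_(m+1))`; equivalently `ca (T_m) ⊆ √(ca (T_(m+1)))`. Assembly:

* the chart-level radical persistence `PersistenceRadical.radicalPersistence_locAt` (H-c, landed)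
  — its binder `hreg` ("the normalised chart is regular off `V(x)`") is DISCHARGED here by the
  landed `PersistenceRegularOffCentre.regularOffCentre` ((R)(c)): `radicalPersistence_of_singEqVCa`,
  `radicalPersistence_locAt_of_singEqVCa` (only `hVCa` remains);
* the identification of one tower step with the normalised affine chart localised at the centre,
  `T_(m+1) = loc (nrm (T_m[ca T_m / x₀]))` for an admissible `x₀` (landed
  `PersistenceLocalStep.locAt_nrm_chart_eq`): `tower_succ_eq_loc_nrm_affChart`;
* an admissible `x₀` exists as soon as `ca (T_m) ∋ x ≠ 0` (landed `di_exists_admissible`), and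
  `x ^ N = (x x₀⁻¹) ^ N · x₀ ^ N` with `x x₀⁻¹ ∈ T_(m+1)` (landed `ca_mul_inv_mem_tower_succ`).

Main statements: `persistenceRadical_tower` (char-free: any fields `k ⊆ K`, any valuation ring
`O ⊇ k`, any finitely generated `A ⊆ O` with `Frac A = K`, every `m`) and
`persistenceRadical_route` (the route binders verbatim, `p`, `CharP k p` decorative), both GIVEN
`singEqVCa_essFiniteType` only.

References: S. B. Iyengar, R. Takahashi, *Annihilation of cohomology and strong generation of
module categories*, IMRN 2016 [`IyengarTakahashi2014`].
-/

-- single-problem summit: the doubled namespace component `ResolutionOfSingularities` is forced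
set_option linter.dupNamespace false

noncomputable section

namespace Summit.ResolutionOfSingularities.ResolutionOfSingularities.Theorems.HomologicalConductor.PersistenceRadical

open Literature.RingTheory.CohomologyAnnihilator (cohomologyAnnihilator singEqVCa_essFiniteType)
open Literature.AlgebraicGeometry.Resolution (isFractionRing_subalgebra_of_le)
open Summit.ResolutionOfSingularities.ResolutionOfSingularities.Theorems.NoZeno.Birth
  (ca nrm loc chart tower tower_succ loc_eq_locAt nrm_eq_nrm ca_subset tn_tower_invariant
    di_exists_admissible mul_mem_ca zero_mem_ca ca_mul_inv_mem_tower_succ)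
open Summit.ResolutionOfSingularities.ResolutionOfSingularities.Theorems.HomologicalConductor.PersistenceLocalStep
  (locAt_nrm_chart_eq)
open Summit.ResolutionOfSingularities.ResolutionOfSingularities.Theorems.HomologicalConductor.PersistenceRegularOffCentre
  (regularOffCentre)

variable {k K : Type} [Field k] [Field K] [Algebra k K]

/-! ## H-c with the regularity binder discharged -/

/-- **Radical persistence on the normalised `ca`-chart, GIVEN Theorem 5.4 only.** For `B ⊆ K`
essentially of finite type over `k` with `Frac B = K` and `x ∈ ca B`: some `x ^ N`, `N ≥ 1`,
lies in `ca (nrm (B[ca B / x]))`. The binder `hreg` of `radicalPersistence` is discharged by the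
landed `regularOffCentre` (the normalised chart is regular off `V(x)`, as
`(nrm B[ca B/x])[x⁻¹] = B[x⁻¹]` is regular); for `x = 0` the statement is `0 ∈ ca`.
[cite: IyengarTakahashi2014, Thm. 5.4] -/
theorem radicalPersistence_of_singEqVCa (hVCa : singEqVCa_essFiniteType.{0}) (B : Subalgebra k K)
    (x : K) (hBft : Algebra.EssFiniteType k ↥B) (hBfrac : IsFractionRing ↥B K) (hx : x ∈ ca B) :
    ∃ N : ℕ, 1 ≤ N ∧ x ^ N ∈ ca (nrm (Algebra.adjoin k ((B : Set K) ∪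
      {y : K | ∃ c ∈ ca B, y = c * x⁻¹}))) := by
  by_cases hx0 : x = 0
  · refine ⟨1, le_rfl, ?_⟩
    rw [hx0, pow_one]
    exact zero_mem_ca _
  · exact radicalPersistence hVCa B x hBft hBfrac hx
      (fun P _ hP => regularOffCentre B x hBft hBfrac hx hx0 P hP)

/-- **Radical persistence at the centre of a valuation ring, GIVEN Theorem 5.4 only.** For
`B ⊆ O` essentially of finite type with `Frac B = K` and `x ∈ ca B` with `c * x⁻¹ ∈ O` for all
`c ∈ ca B`: some `x ^ N`, `N ≥ 1`, lies in `ca (loc O (nrm (B[ca B / x])))` — the radical twin of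
the local re-cut R1 of the core stub, now with its regularity binder discharged
(`regularOffCentre`). [cite: IyengarTakahashi2014, Thm. 5.4] -/
theorem radicalPersistence_locAt_of_singEqVCa (hVCa : singEqVCa_essFiniteType.{0})
    (O : ValuationSubring K) (B : Subalgebra k K) (x : K)
    (hBft : Algebra.EssFiniteType k ↥B) (hBfrac : IsFractionRing ↥B K)
    (hBO : B.toSubring ≤ O.toSubring) (hx : x ∈ ca B) (hmin : ∀ c ∈ ca B, c * x⁻¹ ∈ O) :
    ∃ N : ℕ, 1 ≤ N ∧ x ^ N ∈ ca (loc O (nrm (Algebra.adjoin k ((B : Set K) ∪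
      {y : K | ∃ c ∈ ca B, y = c * x⁻¹})))) := by
  by_cases hx0 : x = 0
  · refine ⟨1, le_rfl, ?_⟩
    rw [hx0, pow_one]
    exact zero_mem_ca _
  · exact radicalPersistence_locAt hVCa O B x hBft hBfrac hBO hx hmin
      (fun P _ hP => regularOffCentre B x hBft hBfrac hx hx0 P hP)

/-! ## One tower step is the normalised affine chart localised at the centre -/

/-- **`T_(m+1) = loc O (nrm (T_m[ca T_m / x₀]))`** for every admissible `x₀ ∈ ca (T_m)` (nonzero, of
minimal `O`-value): the route's chart adjoins the ratios over ALL elements of minimal value, but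
those differ from `x₀` by `O`-units, which the localisation at the centre absorbs (landed
`locAt_nrm_chart_eq`, transported from the image vocabulary along `ca_eq_image`).
[cite: StacksProject, Tag 0307] -/
theorem tower_succ_eq_loc_nrm_affChart (O : ValuationSubring K) (A : Subalgebra k K) (m : ℕ)
    (hTO : (tower O A m).toSubring ≤ O.toSubring) {x₀ : K} (hx₀ : x₀ ∈ ca (tower O A m))
    (hx₀0 : x₀ ≠ 0) (hadm : ∀ c ∈ ca (tower O A m), c * x₀⁻¹ ∈ O) :
    tower O A (m + 1) = loc O (nrm (Algebra.adjoin k (((tower O A m) : Set K) ∪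
      {y : K | ∃ c ∈ ca (tower O A m), y = c * x₀⁻¹}))) := by
  have hx₀' := hx₀
  have hadm' := hadm
  rw [ca_eq_image (tower O A m)] at hx₀' hadm'
  simp only [tower_succ, loc_eq_locAt, nrm_eq_nrm, chart]
  rw [ca_eq_image (tower O A m)]
  exact locAt_nrm_chart_eq O (tower O A m) hTO hx₀' hx₀0 hadm'

/-! ## Rung S-3: radical persistence along the tower -/

/-- **Radical persistence along the canonical tower (rung S-3, char-free), GIVEN Theorem 5.4.**
For fields `k ⊆ K`, a valuation ring `O` of `K` containing `k`, a finitely generated `A ⊆ O`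
with `Frac A = K`, and every `m`: each `x ∈ ca (T_m)` has a power `x ^ N`, `N ≥ 1`, in
`ca (T_(m+1))`. Proof: `x = 0` is trivial; otherwise an admissible `x₀ ∈ ca (T_m)` exists
(`di_exists_admissible`; `T_m` is noetherian, inside `O`, essentially of finite type with
`Frac = K` by `tn_tower_invariant`), `x₀ ^ N ∈ ca (loc O (nrm (T_m[ca T_m/x₀]))) = ca (T_(m+1))`
(`radicalPersistence_locAt_of_singEqVCa`, `tower_succ_eq_loc_nrm_affChart`), and
`x ^ N = (x x₀⁻¹) ^ N · x₀ ^ N` with `x x₀⁻¹ ∈ T_(m+1)` (`ca_mul_inv_mem_tower_succ`), `ca` an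
ideal (`mul_mem_ca`). [cite: IyengarTakahashi2014, Thm. 5.4] -/
theorem persistenceRadical_tower (hVCa : singEqVCa_essFiniteType.{0}) (O : ValuationSubring K)
    (A : Subalgebra k K) (hk : ∀ c : k, algebraMap k K c ∈ O) (hA : A.FG)
    (hfr : IsFractionRing ↥A K) (hAO : A.toSubring ≤ O.toSubring) (m : ℕ) {x : K}
    (hx : x ∈ ca (tower O A m)) : ∃ N : ℕ, 1 ≤ N ∧ x ^ N ∈ ca (tower O A (m + 1)) := by
  by_cases hx0 : x = 0
  · refine ⟨1, le_rfl, ?_⟩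
    rw [hx0, pow_one]
    exact zero_mem_ca _
  obtain ⟨hAT, hTO, hET⟩ := tn_tower_invariant O A hk hA hfr hAO m
  haveI := hET
  haveI := hfr
  haveI : IsNoetherianRing ↥(tower O A m) := Algebra.EssFiniteType.isNoetherianRing k _
  have hTfrac : IsFractionRing ↥(tower O A m) K := isFractionRing_subalgebra_of_le A _ hAT
  have hTO' : ∀ b ∈ tower O A m, b ∈ O := fun b hb => hTO (Subalgebra.mem_toSubring.mpr hb)
  -- an admissible element of `ca (T_m)`
  obtain ⟨x₀, hx₀, hx₀0, hadm⟩ := di_exists_admissible O (tower O A m) hTO' hx hx0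
  -- radical persistence at `x₀`, at the centre of `O`
  obtain ⟨N, hN, hx₀N⟩ :=
    radicalPersistence_locAt_of_singEqVCa hVCa O (tower O A m) x₀ hET hTfrac hTO hx₀ hadm
  rw [← tower_succ_eq_loc_nrm_affChart O A m hTO hx₀ hx₀0 hadm] at hx₀N
  refine ⟨N, hN, ?_⟩
  have hsplit : x ^ N = (x * x₀⁻¹) ^ N * x₀ ^ N := by
    rw [← mul_pow, inv_mul_cancel_right₀ hx₀0]
  rw [hsplit]
  exact mul_mem_ca _ (pow_mem (ca_mul_inv_mem_tower_succ O A m hx₀ hx₀0 hadm hx) N) hx₀N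

/-- **Rung S-3 in subset form**: GIVEN Theorem 5.4, `ca (T_m)` lies in the radical of `ca (T_(m+1))`
— every element of `ca (T_m)` has a positive power in `ca (T_(m+1))`.
[cite: IyengarTakahashi2014, Thm. 5.4] -/
theorem ca_tower_subset_radical_succ (hVCa : singEqVCa_essFiniteType.{0}) (O : ValuationSubring K)
    (A : Subalgebra k K) (hk : ∀ c : k, algebraMap k K c ∈ O) (hA : A.FG)
    (hfr : IsFractionRing ↥A K) (hAO : A.toSubring ≤ O.toSubring) (m : ℕ) :
    ca (tower O A m) ⊆ {x : K | ∃ N : ℕ, 1 ≤ N ∧ x ^ N ∈ ca (tower O A (m + 1))} :=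
  fun _ hx => persistenceRadical_tower hVCa O A hk hA hfr hAO m hx

/-- **Rung S-3 `PersistenceRadical` with the route binders verbatim** (`p`, `CharP k p` are
decorative, cf. the crux's `Disproof.lean`): GIVEN Iyengar–Takahashi's Theorem 5.4, for every
prime `p`, fields `k` of characteristic `p` and `K ⊇ k`, valuation ring `O ⊇ k` of `K`, finitely
generated `A ⊆ O` with `Frac A = K`, every `m` and every `x ∈ ca (T_m)`: `x ^ N ∈ ca (T_(m+1))`
for some `N ≥ 1`. This is the repaired statement `C′` of the crux `Persistence` (exponent `N`
instead of exponent one), banked regardless of the fate of exponent one.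
[cite: IyengarTakahashi2014, Thm. 5.4] -/
theorem persistenceRadical_route (hVCa : singEqVCa_essFiniteType.{0}) :
    ∀ p : ℕ, p.Prime → ∀ (k K : Type) [Field k] [CharP k p] [Field K] [Algebra k K]
      (O : ValuationSubring K) (A : Subalgebra k K), (∀ c : k, algebraMap k K c ∈ O) → A.FG →
      IsFractionRing ↥A K → A.toSubring ≤ O.toSubring →
      ∀ m : ℕ, ∀ x ∈ ca (tower O A m), ∃ N : ℕ, 1 ≤ N ∧ x ^ N ∈ ca (tower O A (m + 1)) :=
  fun _ _ _ _ _ _ _ _ O A hk hA hfr hAO m _ hx => persistenceRadical_tower hVCa O A hk hA hfr hAO m hx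

end Summit.ResolutionOfSingularities.ResolutionOfSingularities.Theorems.HomologicalConductor.PersistenceRadical

end
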